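import Summits.QuantumFields.YangMills.Theorems.FluctuationComparisonRegPrIntLS2BetaSigmaGrowthRate
import Summits.QuantumFields.YangMills.Theorems.UnitScaleTiltProp7SigmaRepOfThm2S
import Summits.QuantumFields.YangMills.Theorems.UnitScaleTiltProp7Thm2SocketOfCoverForm
import Summits.QuantumFields.YangMills.Theorems.UnitScaleTiltProp7CritEL
import HarnessLib

/-!
# S2β · organ GAP♯∘ ∕ TUBE-REG∘ — **(142) WITH ITS K-UNIFORM RATE IN THE ORGAN's OWN CURRENCY: ORBIT-`dist1²` GROWTH OVER THE REGULAR COMPETITORS OF THE FIBRE**,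
# ZERO HYPOTHESES AT EVERY BLOCK SIZE `L ≥ 5` (the [B8] Thm-2 socket displayed for all `L > 1`)

Cell `ym3-torus` (rung R3 = SU(2) YM₃ on T³ — NOT d = 4, NOT infinite volume, NOT a mass gap, NOT Clay).  Width seat `ym3-torus-px17` (gen 15), FREE px helper of `stmt-QuantumFields-20520`
(`--supports … --as helper`, count-neutral); DEFINITION-FREE (0 `def`∕`instance`∕`notation`∕`sorry`, default heartbeats).

WHY.  TUBE-REG∘ (`hT1` of ✓`uniformFibreGapOrbit_of_tubeReg_of_thm1`) and GAP♯∘ read the growth of the Wilson action on the fibre over `V` in the currency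
`μ·L^{−2(K−J)}·⨅_w Σ_ℓ dist1(U ℓ · ((w • U₀) ℓ)⁻¹)²` (orbit distance to the residual-gauge orbit of the minimiser).  ✓`…S2BetaSigmaGrowthRate.sigmaGrowth_holds` gives (142) with its rate
on the Landau Σ-slice (`c·(L^{K−n})⁻²·Σ_b‖X b‖² ≤ A(W·e^{iX}) − A(W)`), and ✓`Prop7SigmaRepOfThm2S.exists_sigmaRep_of_thm2S` (px13) represents EVERY regular competitor `W′ ∈ (6)(e) ∩ 𝔅_k(V)` as
`W′ = u • (e^{iX}·W)` with `X` in print's (19)(20)(21) window and `A(W′) = A(e^{iX}·W)` — from the [Balaban1985RegularSpaces] Thm-2 socket `hThm2S`, itself a THEOREM at every `L ≥ 5`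
(✓`Prop7Thm2SocketOfCoverForm.hThm2S_body_of_five_le`).  Per bond `W′ ℓ · ((u • W) ℓ)⁻¹ = u(ℓ₋)·e^{iX ℓ}·u(ℓ₋)⁻¹`, so `dist1(…) = dist1(e^{iX ℓ}) ≤ ‖X ℓ‖` ([Balaban1985Averaging] (24)).
THIS FILE composes the three:
* §1 `dist1_sigmaRep_bond_le` — the per-bond dictionary `dist1((u • (e^{iX}·W)) ℓ · ((u • W) ℓ)⁻¹) ≤ ‖X ℓ‖` for Hermitian-traceless `X`.
* §2 ★★★ `orbitGrowth_of_regular_of_thm2S (hThm2S)` — for the socket's `L`: `∃ e₈ c > 0` such that at every member, datum `V`, every E–L-critical `W ∈ regFibrePr F n K e V` (`0 < e ≤ e₈`)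
  and EVERY `W′ ∈ regFibrePr F n K e V`: `∃ u : GaugeTransf`, `c·(L^{K−n})⁻²·Σ_ℓ dist1(W′ ℓ · ((u • W) ℓ)⁻¹)² ≤ A(W′) − A(W)`.
* §3 ★★★★ `orbitGrowth_of_regular_five (L) (h5 : 5 ≤ L)` — §2 ∘ ✓`hThm2S_body_of_five_le`: **NO HYPOTHESIS at every block size `L ≥ 5`** (the per-L corollary lane, ★★OWNER №224 (3)).
* §4 ★★★★ `orbitGrowth_of_isCritR2_five` — §3 with the E–L binder discharged by Fermat for a MINIMISER over a regular fibre (`IsCritR2`; ✓`Prop7CritEL`).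
RESIDUE towards TUBE-REG∘∕GAP♭ (located, not typed): (a) competitors here are REGULAR (`(6)(e)`), TUBE-REG∘'s are good histories in a datum-free `δ`-tube (prover-3 (F3): the gap between the
two is REG-ARGMIN̄∕ISOL∘-type, not coercivity); (b) `u` is the representative's gauge of ✓`exists_sigmaRep_of_thm2S` (`v⁻¹·u_COV`), whose membership in the residual group
`{w | descendTo (w • ·) = descendTo ·}` is the group-(4) bookkeeping (px13 LOCATE-GAP♯ §2); (c) E–L-criticality of the organ's `U₀ ∈ argminHist V ∩ regFibrePr ε₀` (a constrained minimiser).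
HONEST SCOPE.  Composition of landed theorems + one per-bond norm inequality; nothing of Bałaban's analysis asserted beyond the cited tree theorems; credits nothing; TUBE-REG∘, GAP♯∘, EXW∘,
20520, `YM3TorusSU2` NOT proved; at `L = 3` §2's socket is [B8] Thm 2 (open, EMBARGO-LITE №58).  The Yang–Mills mass gap is NOT proved.
References: T. Bałaban, CMP **102** (1985) 277–309 [Balaban1985Variational] (Prop. 2 p.281, (19)–(21) p.281, (141)–(143) p.299); CMP **99** (1985) 75–102 [Balaban1985RegularSpaces] (Thm 2 p.83,
(1.36)–(1.38) p.82); CMP **98** (1985) 17–51 [Balaban1985Averaging] ((8) p.19, (24) p.21); CMP **99** (1985) 389–434 [Balaban1985BackgroundPropagators] (Thm 3.11 p.416).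
-/

set_option autoImplicit false
noncomputable section

open scoped BigOperators Matrix.Norms.L2Operator Matrix

namespace Summit.QuantumFields.YangMills.Theorems.FluctuationComparisonRegPrIntLS2BetaOrbitGrowthOfRegular

open NormedSpace
open Literature.MathematicalPhysics.QuantumFieldTheory.Balaban1983to89
open Literature.MathematicalPhysics.QuantumFieldTheory.Balaban1983to89.T3ContinuumYM3Torus
open Literature.MathematicalPhysics.QuantumFieldTheory.Balaban1983to89.T3UnitLawDensityEML (ℰp)
open Literature.MathematicalPhysics.QuantumFieldTheory.Balaban1983to89.T3ConstrainedMinimiser (fibre)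
open Literature.MathematicalPhysics.QuantumFieldTheory.Balaban1983to89.T3PrintedRegularMinimiser
open Literature.MathematicalPhysics.QuantumFieldTheory.Balaban1983to89.T3RegularMinimiser
open T3SectALandauChart (emb15 In19)
open B7Prop2Explicit (C0 c2')
open B7Prop1Explicit renaming Site → LSite
open B8Thm2SetupTorus (Thm2SetupSUAt)
open Summit.QuantumFields.YangMills.Theorems.Prop7SPrint (AvgCondPrint IsLandauPrint)
open Summit.QuantumFields.YangMills.Theorems.Prop7TPrint (expHerm coe_expHerm expHermField expHermField_apply)
open Summit.QuantumFields.YangMills.Theorems.FluctuationComparisonRegPrIntLS2BetaSigmaGrowthRate (sigmaGrowth_holds)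
open Summit.QuantumFields.YangMills.Theorems.Prop7SigmaRepOfThm2S (exists_sigmaRep_of_thm2S)
open Summit.QuantumFields.YangMills.Theorems.Prop7Thm2SocketOfCoverForm (hThm2S_body_of_five_le)
open T3SectALandauChart (eta)
open Literature.MathematicalPhysics.QuantumFieldTheory.Balaban1983to89.T3Thm1CarrierNative (IsCritR2)
open Summit.QuantumFields.YangMills.Theorems.Prop7CritEL (deriv_comp_eq_zero_of_isCritR2 continuousAt_of_differentiableAt_bonds)

/-! ## §1 The per-bond dictionary -/

/-- §1 **PER-BOND DICTIONARY**: for Hermitian-traceless `X ℓ`, `dist1((u • (e^{iX}·W)) ℓ · ((u • W) ℓ)⁻¹) ≤ ‖X ℓ‖` — the bond quotient is the conjugate `u(ℓ₋)·e^{iX ℓ}·u(ℓ₋)⁻¹`,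
`dist1` is a class function, and `‖e^{iX} − 1‖ ≤ ‖X‖` for Hermitian `X` ([Balaban1985Averaging] (24)). [cite: Balaban1985Averaging, (8) p.19, (24) p.21] -/
theorem dist1_sigmaRep_bond_le {F : T3Family} {K : ℕ} (u : GaugeTransf (F.P K) 0 (Matrix.specialUnitaryGroup (Fin 2) ℂ))
    (W : GaugeField (F.P K) 0 (Matrix.specialUnitaryGroup (Fin 2) ℂ)) (X : PBond (F.P K) 0 → Matrix (Fin 2) (Fin 2) ℂ)
    (hX : ∀ b : PBond (F.P K) 0, (X b).IsHermitian ∧ Matrix.trace (X b) = 0) (ℓ : PBond (F.P K) 0) :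
    dist1 ((GaugeField.gaugeAct u (emb15 W (expHermField X))) ℓ * ((GaugeField.gaugeAct u W) ℓ)⁻¹) ≤ ‖X ℓ‖ := by
  letI : CStarAlgebra (Matrix (Fin 2) (Fin 2) ℂ) := B10Eq29TubeLine.cstarAlgebraMatrix 2
  have hq : (GaugeField.gaugeAct u (emb15 W (expHermField X))) ℓ * ((GaugeField.gaugeAct u W) ℓ)⁻¹ = u ℓ.src * expHermField X ℓ * (u ℓ.src)⁻¹ := by
    simp only [GaugeField.gaugeAct, emb15]
    group
  rw [hq, GaugeGroup.dist1_conj, SU2Mean.dist1_eq_norm, expHermField_apply, coe_expHerm (hX ℓ)]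
  exact B8Ineq170.norm_exp_I_smul_sub_one_le (hX ℓ).1

/-! ## §2 Orbit growth over regular competitors from the Thm-2 socket -/

/-- ★★★ **(142) WITH ITS K-UNIFORM RATE IN ORBIT-`dist1²` CURRENCY OVER THE REGULAR COMPETITORS, FROM THE [Balaban1985RegularSpaces] THM-2 SOCKET** — ✓`sigmaGrowth_holds` ∘ ✓`exists_sigmaRep_of_thm2S` ∘ §1.
For the socket's block size `L`: `∃ e₈ c > 0` such that at every member `(F, n < K)`, every datum `V`, every `W ∈ regFibrePr F n K e V` (`0 < e ≤ e₈`) E–L-critical along differentiable fibre curves,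
and every `W′ ∈ regFibrePr F n K e V`, some gauge transformation `u` has `c·(L^{K−n})⁻²·Σ_ℓ dist1(W′ ℓ · ((u • W) ℓ)⁻¹)² ≤ A(W′) − A(W)`.
[cite: Balaban1985Variational, (141)-(143) p.299, Prop. 2 p.281; Balaban1985RegularSpaces, Thm 2 p.83; Balaban1985BackgroundPropagators, Thm 3.11 p.416] -/
theorem orbitGrowth_of_regular_of_thm2S {L : ℕ} (hL : 1 < L) {B₁ c₁ : ℝ} (hB₁ : 0 < B₁) (hc₁ : 0 < c₁)
    (hThm2S : ∀ (F : T3Family), F.L = L → ∀ (n K : ℕ), n < K →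
      ∃ (β₀ B₂ : ℝ) (len : LSite (F.P K).d → ℝ), Thm2SetupSUAt (F.P K) 2 (K - n) (eta F n K) β₀ B₁ B₂ c₁ len (fun _ => True)) :
    ∃ e₈ c : ℝ, 0 < e₈ ∧ 0 < c ∧
      ∀ (F : T3Family), F.L = L → ∀ (n K : ℕ) (hnK : n < K) (e : ℝ) (V : GaugeField (F.P n) 0 (Matrix.specialUnitaryGroup (Fin 2) ℂ))
        (W : GaugeField (F.P K) 0 (Matrix.specialUnitaryGroup (Fin 2) ℂ)),
        0 < e → e ≤ e₈ → W ∈ regFibrePr F n K hnK.le e V →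
        (∀ γ : ℝ → GaugeField (F.P K) 0 (Matrix.specialUnitaryGroup (Fin 2) ℂ), γ 0 = W → (∀ t, γ t ∈ fibre F ℰp n K hnK.le V) →
          (∀ b, DifferentiableAt ℝ (fun t => ((γ t b : Matrix.specialUnitaryGroup (Fin 2) ℂ) : Matrix (Fin 2) (Fin 2) ℂ)) 0) →
            deriv (fun t => wilsonAction4 (γ t)) 0 = 0) →
        ∀ W' : GaugeField (F.P K) 0 (Matrix.specialUnitaryGroup (Fin 2) ℂ), W' ∈ regFibrePr F n K hnK.le e V →
          ∃ u : GaugeTransf (F.P K) 0 (Matrix.specialUnitaryGroup (Fin 2) ℂ),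
            c * (((F.L : ℝ) ^ (K - n)) ^ 2)⁻¹ * (∑ ℓ : PBond (F.P K) 0, dist1 (W' ℓ * ((GaugeField.gaugeAct u W) ℓ)⁻¹) ^ 2)
              ≤ wilsonAction4 W' - wilsonAction4 W := by
  -- the Σ-representation constants from the Thm-2 socket, then the growth constants at `B₁′`
  obtain ⟨B₁', c₁', hB₁', hc₁', HREP⟩ := exists_sigmaRep_of_thm2S (L := L) hB₁ hc₁ hThm2S
  obtain ⟨e₇, c, he₇, hc, HGROW⟩ := sigmaGrowth_holds L hL B₁' hB₁'
  -- the three L-only windows of the representative (`2e ≤ c₁′`, `C0 3·(2e) ≤ ⅓`, `2(2e) ≤ c2′ 3 L`)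
  have hC0 : 0 < C0 3 := B7Prop2Explicit.C0_pos 3
  have hc2 : 0 < c2' 3 L := B7Prop2Explicit.c2'_pos 3 L (by omega)
  refine ⟨min e₇ (min (c₁' / 2) (min (1 / (6 * C0 3)) (c2' 3 L / 4))), c,
    lt_min he₇ (lt_min (by positivity) (lt_min (by positivity) (by positivity))), hc, ?_⟩
  intro F hF n K hnK e V W he he₈ hW hEL W' hW'
  have he₇' : e ≤ e₇ := he₈.trans (min_le_left _ _)
  have h2e : 2 * e ≤ c₁' := by
    have := (he₈.trans (min_le_right _ _)).trans (min_le_left _ _); linarith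
  have hα3 : C0 3 * (2 * e) ≤ 1 / 3 := by
    have h1 : e ≤ 1 / (6 * C0 3) := ((he₈.trans (min_le_right _ _)).trans (min_le_right _ _)).trans (min_le_left _ _)
    rw [le_div_iff₀ (by positivity)] at h1
    linarith
  have hα2 : 2 * (2 * e) ≤ c2' 3 L := by
    have h1 : e ≤ c2' 3 L / 4 := ((he₈.trans (min_le_right _ _)).trans (min_le_right _ _)).trans (min_le_right _ _)
    linarith
  obtain ⟨u, X, hW'eq, h19, h20, h21, hA⟩ := HREP F hF n K hnK e V W he h2e hα3 hα2 hW W' hW'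
  refine ⟨u, ?_⟩
  have hgrow := HGROW F hF n K hnK e V W X he he₇' hW hEL h19 h20 h21
  -- per-bond dictionary: `dist1 ≤ ‖X ℓ‖`
  have hX : ∀ b : PBond (F.P K) 0, (X b).IsHermitian ∧ Matrix.trace (X b) = 0 := h19.1
  have hsum : ∑ ℓ : PBond (F.P K) 0, dist1 (W' ℓ * ((GaugeField.gaugeAct u W) ℓ)⁻¹) ^ 2 ≤ ∑ ℓ : PBond (F.P K) 0, ‖X ℓ‖ ^ 2 := by
    refine Finset.sum_le_sum fun ℓ _ => ?_
    have h1 := dist1_sigmaRep_bond_le u W X hX ℓ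
    rw [← hW'eq] at h1
    exact pow_le_pow_left₀ (GaugeGroup.dist1_nonneg _) h1 2
  have hc0 : 0 ≤ c * (((F.L : ℝ) ^ (K - n)) ^ 2)⁻¹ := by
    have : (0 : ℝ) ≤ ((F.L : ℝ) ^ (K - n)) ^ 2 := by positivity
    exact mul_nonneg hc.le (inv_nonneg.mpr this)
  calc c * (((F.L : ℝ) ^ (K - n)) ^ 2)⁻¹ * (∑ ℓ : PBond (F.P K) 0, dist1 (W' ℓ * ((GaugeField.gaugeAct u W) ℓ)⁻¹) ^ 2)
      ≤ c * (((F.L : ℝ) ^ (K - n)) ^ 2)⁻¹ * (∑ b : PBond (F.P K) 0, ‖X b‖ ^ 2) := mul_le_mul_of_nonneg_left hsum hc0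
    _ ≤ wilsonAction4 (emb15 W (expHermField X)) - wilsonAction4 W := hgrow
    _ = wilsonAction4 W' - wilsonAction4 W := by rw [hA]

/-! ## §3 ZERO HYPOTHESES at every block size `L ≥ 5` -/

/-- ★★★★ **ORBIT-`dist1²` GROWTH OVER THE REGULAR COMPETITORS, K-UNIFORM RATE, NO HYPOTHESIS, EVERY BLOCK SIZE `L ≥ 5`** — §2 ∘ ✓`hThm2S_body_of_five_le` (the [B8] Thm-2 socket is a
tree theorem at `L ≥ 5`; at `L = 3` it is the open letter of the EX∕19200 cone).  For every `L ≥ 5` there are `e₈, c > 0` such that at every member `(F, n < K)`, datum `V`, every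
E–L-critical `W ∈ regFibrePr F n K e V` (`0 < e ≤ e₈`) and every `W′ ∈ regFibrePr F n K e V`: `∃ u`, `c·(L^{K−n})⁻²·Σ_ℓ dist1(W′ ℓ · ((u • W) ℓ)⁻¹)² ≤ A(W′) − A(W)`.
[cite: Balaban1985Variational, (141)-(143) p.299; Balaban1985RegularSpaces, Thm 2 p.83; Balaban1985BackgroundPropagators, Thm 3.11 p.416] -/
theorem orbitGrowth_of_regular_five (L : ℕ) (h5 : 5 ≤ L) :
    ∃ e₈ c : ℝ, 0 < e₈ ∧ 0 < c ∧
      ∀ (F : T3Family), F.L = L → ∀ (n K : ℕ) (hnK : n < K) (e : ℝ) (V : GaugeField (F.P n) 0 (Matrix.specialUnitaryGroup (Fin 2) ℂ))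
        (W : GaugeField (F.P K) 0 (Matrix.specialUnitaryGroup (Fin 2) ℂ)),
        0 < e → e ≤ e₈ → W ∈ regFibrePr F n K hnK.le e V →
        (∀ γ : ℝ → GaugeField (F.P K) 0 (Matrix.specialUnitaryGroup (Fin 2) ℂ), γ 0 = W → (∀ t, γ t ∈ fibre F ℰp n K hnK.le V) →
          (∀ b, DifferentiableAt ℝ (fun t => ((γ t b : Matrix.specialUnitaryGroup (Fin 2) ℂ) : Matrix (Fin 2) (Fin 2) ℂ)) 0) →
            deriv (fun t => wilsonAction4 (γ t)) 0 = 0) →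
        ∀ W' : GaugeField (F.P K) 0 (Matrix.specialUnitaryGroup (Fin 2) ℂ), W' ∈ regFibrePr F n K hnK.le e V →
          ∃ u : GaugeTransf (F.P K) 0 (Matrix.specialUnitaryGroup (Fin 2) ℂ),
            c * (((F.L : ℝ) ^ (K - n)) ^ 2)⁻¹ * (∑ ℓ : PBond (F.P K) 0, dist1 (W' ℓ * ((GaugeField.gaugeAct u W) ℓ)⁻¹) ^ 2)
              ≤ wilsonAction4 W' - wilsonAction4 W := by
  obtain ⟨B₁, c₁, hB₁, hc₁, hT⟩ := hThm2S_body_of_five_le L h5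
  exact orbitGrowth_of_regular_of_thm2S (by omega) hB₁ hc₁ hT

/-! ## §4 The organ-facing edition: the base point is a MINIMISER over the regular fibre (E–L by Fermat, ✓`Prop7CritEL`) -/

/-- ★★★★ **ORBIT-`dist1²` GROWTH AT A MINIMISER OVER THE REGULAR FIBRE, NO HYPOTHESIS, EVERY `L ≥ 5`** — §3 with the E–L binder discharged by Fermat: a minimiser of the Wilson action over
`regFibrePr F n K e′ V` (reading R2, `IsCritR2`) is E–L-critical along every bondwise-differentiable fibre curve (✓`Prop7CritEL.deriv_comp_eq_zero_of_isCritR2` ∘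
✓`continuousAt_of_differentiableAt_bonds`, (6) open).  So: for every `L ≥ 5` there are `e₈, c > 0` such that at every member, datum `V`, every `W ∈ regFibrePr F n K e V` (`0 < e ≤ e₈`)
minimising the action over some regular fibre `regFibrePr F n K e′ V`, and every `W′ ∈ regFibrePr F n K e V`: `∃ u`, `c·(L^{K−n})⁻²·Σ_ℓ dist1(W′ ℓ · ((u • W) ℓ)⁻¹)² ≤ A(W′) − A(W)` —
the organ's base point `U₀ ∈ argminHist V ∩ regFibrePr ε₀` is of this kind once it minimises over `(6)(ε₀)` (Thm 1 (8) ∕ REG-ARGMIN̄ lane).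
[cite: Balaban1985Variational, (141)-(143) p.299, (5)-(6) p.278, (111) p.294; Balaban1985RegularSpaces, Thm 2 p.83] -/
theorem orbitGrowth_of_isCritR2_five (L : ℕ) (h5 : 5 ≤ L) :
    ∃ e₈ c : ℝ, 0 < e₈ ∧ 0 < c ∧
      ∀ (F : T3Family), F.L = L → ∀ (n K : ℕ) (hnK : n < K) (e : ℝ) (V : GaugeField (F.P n) 0 (Matrix.specialUnitaryGroup (Fin 2) ℂ))
        (W : GaugeField (F.P K) 0 (Matrix.specialUnitaryGroup (Fin 2) ℂ)),
        0 < e → e ≤ e₈ → W ∈ regFibrePr F n K hnK.le e V → IsCritR2 F n K hnK.le V W →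
        ∀ W' : GaugeField (F.P K) 0 (Matrix.specialUnitaryGroup (Fin 2) ℂ), W' ∈ regFibrePr F n K hnK.le e V →
          ∃ u : GaugeTransf (F.P K) 0 (Matrix.specialUnitaryGroup (Fin 2) ℂ),
            c * (((F.L : ℝ) ^ (K - n)) ^ 2)⁻¹ * (∑ ℓ : PBond (F.P K) 0, dist1 (W' ℓ * ((GaugeField.gaugeAct u W) ℓ)⁻¹) ^ 2)
              ≤ wilsonAction4 W' - wilsonAction4 W := by
  obtain ⟨e₈, c, he₈, hc, H⟩ := orbitGrowth_of_regular_five L h5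
  refine ⟨e₈, c, he₈, hc, fun F hF n K hnK e V W he heε hW hcrit W' hW' => H F hF n K hnK e V W he heε hW ?_ W' hW'⟩
  intro γ hγ0 hγfib hγd
  exact deriv_comp_eq_zero_of_isCritR2 hcrit γ hγ0 hγfib (continuousAt_of_differentiableAt_bonds γ hγd)

end Summit.QuantumFields.YangMills.Theorems.FluctuationComparisonRegPrIntLS2BetaOrbitGrowthOfRegular

end
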